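import Literature.AlgebraicGeometry.AbelianSchemes.InducedGroupLawOfPoint
import Literature.AlgebraicGeometry.Dimension.SmoothRelativeDimensionLocus
import Mathlib.AlgebraicGeometry.Morphisms.Smooth
import Mathlib.AlgebraicGeometry.Morphisms.Proper
import Mathlib.AlgebraicGeometry.Noetherian
import HarnessLib

/-!
# The open sub-functor «group law with prescribed unit, smooth of relative dimension `g`» of a smooth projective family:
# assembly from an open law locus ([MumfordFogartyKirwan1994] Ch. 6 §3 Prop. 6.16, Ch. 7 §2 Prop. 7.3 step (II))

Topic `Literature/AlgebraicGeometry/AbelianSchemes`; namespace `Literature.AlgebraicGeometry.AbelianSchemes`.  THEOREMS ONLY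
(no definition, no named fact, no instance, no notation, no `sorry`).  Cell hodgecm-mathlib (D-0151 ∕ FLOOR 0), P1 sub-line
F-4 `F4LinearRigidificationII`, layer 2, sub-stub **(II-e) `stub_IIe_assembly`** of the typer's menu (B-typ03 (g19), v2∕v3
§5, segment d8821c03) — stated here TOKEN FOR TOKEN as `groupLawLocus_assembly` and PROVED.  HC_CM is proved only modulo the
7 printed citations until rung 0 closes; this file discharges none of them.

THE PRINT.  [MumfordFogartyKirwan1994, Ch. 6 §3 Prop. 6.16 (p. 125)]: for a projective (here: proper) smooth `p₁ : Z₁ → H₁`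
with geometrically connected fibres and a section `ε₁`, «the sub-functor of points `T → H₁` such that `Z₁ ×_{H₁} T` carries a structure of abelian scheme over `T` with identity `ε₁ ×_{H₁} T` is represented by an OPEN subscheme»; Ch. 7 §2 Prop. 7.3
step (II) (p. 132) uses it with the dimension fixed («abelian scheme of dimension `g`»).  The proof on p. 126 produces the
open law locus `ω : Z ↪ H₁` with its universal law `G_Z`; THIS FILE is the final bookkeeping step from `(Z, ω, G_Z)` to the
letter of the line's `stub_IIrep′`:

* (§1 = ★-to-be `AbelianSchemes/InducedGroupLawOfPoint`, B-typ03 (g19)'s seed c5995478 in its own leaf per the F-4 lead's ruling 19:55:03Z: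
  `AbelianSchemeOver.exists_inducedLaw_of_point`, the (G3) transport of a law along a point `T → Z`; imported and used BY NAME below.)
* §2 **`groupLawLocus_assembly`** = (II-e): from an OPEN IMMERSION `ω : Z → H₁` carrying `G_Z` with unit `ε₁|_Z` such that,
  on locally Noetherian `T`, `v : T → H₁` factors (uniquely) through `ω` iff `Z₁ ×_{H₁} T → T` carries a group law with unit
  `ε₁|_T`, one gets an open immersion `j₂ : H₂ → H₁` with a group law `G` on `Z₁ ×_{H₁} H₂`, unit `ε₁|_{H₂}`, smooth of
  relative dimension `g`, such that for EVERY scheme `T`, `v` factors (uniquely) through `j₂` iff `Z₁ ×_{H₁} T → T` carries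
  a group law with unit `ε₁|_T` AND is smooth of relative dimension `g`.

PROOF of §2.  Let `q : E := Z₁ ×_{H₁} Z → Z` (proper, smooth, geometrically connected fibres) and `s : Z → E` the unit of
`G_Z` (a section of `q`).  Let `U ⊆ E` be the largest open on which `q` has relative dimension `g` (★
`Dimension.exists_opens_smoothOfRelativeDimension_maximal`); it is open AND CLOSED (★
`Dimension.isClopen_of_smoothOfRelativeDimension_maximal`), and the fibres of `q` are connected (Mathlib
`Scheme.Hom.isConnected_preimage_singleton`), so a fibre meeting `U` lies in `U`.  Put `H₂ := W := s⁻¹(U)` (open in `Z`)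
and `j₂ := W ↪ Z → H₁`; then `q⁻¹(W) ⊆ U`, so `Z₁ ×_{H₁} W → W` — an open piece of `U → Z` over `W` — is smooth of relative
dimension `g`; the law `G` is `G_Z` transported along `W ↪ Z` (§1).  For the universal property on an ARBITRARY `T`: (→)
transport `G` along `w : T → H₂` (§1) and base-change the relative dimension; (←) a group law on `Z₁ ×_{H₁} T` with unit
`ε₁|_T` restricts (§1) to the residue field `Spec κ(t)` of any `t ∈ T`, which is Noetherian, so `Spec κ(t) → H₁` factors
through `ω` by a point `w₀` of `Z`; the fibre of `q` at `w₀` is `Z₁ ×_{H₁} Spec κ(t)`, smooth of relative dimension `g`, hence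
inside `U` (★ `Dimension.mem_of_smoothOfRelativeDimension_pullback_snd`), i.e. `w₀ ∈ W`; so `v(T) ⊆ j₂(H₂)` and `v` factors
through the open immersion `j₂` (Mathlib `IsOpenImmersion.lift`), uniquely (`j₂` is a monomorphism).

## References
* [MumfordFogartyKirwan1994] D. Mumford, J. Fogarty, F. Kirwan, *Geometric Invariant Theory*, 3rd ed. (1994), Ch. 6 §3
  Proposition 6.16 (p. 125) and its proof (p. 126); Ch. 7 §2 Proposition 7.3, step (II) (p. 132); Ch. 7 §2 Definition 7.2
  (p. 129) (base change of group schemes).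
* [GortzWedhorn2020] U. Görtz, T. Wedhorn, *Algebraic Geometry I*, 2nd ed. (2020), Section (4.7) (base change), Prop. 6.15 (1),
  Remark 16.54.
-/

set_option autoImplicit false

-- Mathlib's `Over`/pull-back API is stated across semireducible wrappers (as in the ★ `AbelianSchemes/*` files).
set_option backward.isDefEq.respectTransparency false

universe u

open CategoryTheory CategoryTheory.Limits AlgebraicGeometry MonoidalCategory

namespace Literature.AlgebraicGeometry.AbelianSchemes

open Literature.AlgebraicGeometry.Dimension
open scoped MonObj

/-! ### §2 (II-e) The assembly: relative-dimension-`g` part of an open law locus, and all test schemes -/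

/-- **(II-e) `stub_IIe_assembly` — from an open law locus to the letter of `stub_IIrep′`** ([MumfordFogartyKirwan1994] Ch. 6 §3
Prop. 6.16 (p. 125) + Ch. 7 §2 Prop. 7.3 step (II) (p. 132), bookkeeping).  For `p₁ : Z₁ → H₁` proper smooth with geometrically
connected fibres and a section `ε₁`, and an OPEN IMMERSION `ω : Z → H₁` carrying a group law `G_Z` on `Z₁ ×_{H₁} Z` with unit
`ε₁`, such that on locally Noetherian `T` a morphism `v : T → H₁` factors (uniquely) through `ω` iff `Z₁ ×_{H₁} T → T` carries a
group law with unit `ε₁|_T`: there is an open immersion `j₂ : H₂ → H₁` (the part of `Z` over which the relative dimension is `g`)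
with a group law `G` on `Z₁ ×_{H₁} H₂`, unit `ε₁|_{H₂}`, smooth of relative dimension `g`, such that for EVERY scheme `T`,
`v : T → H₁` factors (uniquely) through `j₂` iff `Z₁ ×_{H₁} T → T` carries a group law with unit `ε₁|_T` and is smooth of
relative dimension `g`.  Proof in the module docstring (largest relative-dimension-`g` open of `Z₁ ×_{H₁} Z → Z` is open and
closed, fibres connected and met by the unit section; transport §1; residue fields for arbitrary `T`; `IsOpenImmersion.lift`).
Statement = the F-4 typer's menu (B-typ03 (g19) v2 c06b2992 ∕ v3, §5 segment d8821c03) token for token. [MODULI-STANDARD]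
[cite: MumfordFogartyKirwan1994, Ch. 6 §3 Proposition 6.16 (p. 126); Ch. 7 §2 Proposition 7.3, step (II) (p. 132)] -/
theorem groupLawLocus_assembly : ∀ (g : ℕ) ⦃H₁ Z₁ : Scheme.{0}⦄ (p₁ : Z₁ ⟶ H₁) [IsProper p₁] [Smooth p₁]
    [GeometricallyConnected p₁] (ε₁ : H₁ ⟶ Z₁) (_ : ε₁ ≫ p₁ = 𝟙 H₁)
    ⦃Z : Scheme.{0}⦄ (ω : Z ⟶ H₁) [IsOpenImmersion ω] (GZ : GrpObj (Over.mk (pullback.snd p₁ ω))),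
    (@MonObj.one _ _ _ (Over.mk (pullback.snd p₁ ω)) GZ.toMonObj).left ≫ pullback.fst p₁ ω = ω ≫ ε₁ →
    (∀ ⦃T : Scheme.{0}⦄ [IsLocallyNoetherian T] (v : T ⟶ H₁),
        (∃! w : T ⟶ Z, w ≫ ω = v) ↔
          ∃ G' : GrpObj (Over.mk (pullback.snd p₁ v)),
            (@MonObj.one _ _ _ (Over.mk (pullback.snd p₁ v)) G'.toMonObj).left ≫ pullback.fst p₁ v = v ≫ ε₁) →
    ∃ (H₂ : Scheme.{0}) (j₂ : H₂ ⟶ H₁) (_ : IsOpenImmersion j₂)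
    (G : GrpObj (Over.mk (pullback.snd p₁ j₂))),
      (@MonObj.one _ _ _ (Over.mk (pullback.snd p₁ j₂)) G.toMonObj).left ≫ pullback.fst p₁ j₂ = j₂ ≫ ε₁ ∧
      SmoothOfRelativeDimension g (pullback.snd p₁ j₂) ∧
      ∀ ⦃T : Scheme.{0}⦄ (v : T ⟶ H₁),
        (∃! w : T ⟶ H₂, w ≫ j₂ = v) ↔
          ∃ G' : GrpObj (Over.mk (pullback.snd p₁ v)),
            (@MonObj.one _ _ _ (Over.mk (pullback.snd p₁ v)) G'.toMonObj).left ≫ pullback.fst p₁ v = v ≫ ε₁ ∧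
            SmoothOfRelativeDimension g (pullback.snd p₁ v) := by
  intro g H₁ Z₁ p₁ _ _ _ ε₁ hε₁ Z ω _ GZ hunit hiff
  -- the unit of `G_Z` is a section `s` of `q : E := Z₁ ×_{H₁} Z → Z`
  obtain ⟨s, hs_def⟩ : ∃ s : Z ⟶ pullback p₁ ω,
      s = (@MonObj.one _ _ _ (Over.mk (pullback.snd p₁ ω)) GZ.toMonObj).left := ⟨_, rfl⟩
  have hs : s ≫ pullback.snd p₁ ω = 𝟙 Z := by
    rw [hs_def]
    simpa using Over.w (@MonObj.one _ _ _ (Over.mk (pullback.snd p₁ ω)) GZ.toMonObj)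
  have hsq : ∀ z : Z, pullback.snd p₁ ω (s z) = z := by
    intro z
    rw [← Scheme.Hom.comp_apply, hs]
    simp
  -- `U ⊆ E`: the largest open of relative dimension `g`; it is open and closed, and the fibres of `q` are connected
  obtain ⟨U, hU, hUmax⟩ := exists_opens_smoothOfRelativeDimension_maximal (pullback.snd p₁ ω) g
  have hUc : IsClopen (U : Set ↥(pullback p₁ ω)) := isClopen_of_smoothOfRelativeDimension_maximal _ hU hUmax
  have hfib : ∀ x : ↥(pullback p₁ ω), s (pullback.snd p₁ ω x) ∈ U → x ∈ U := by
    intro x hx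
    have hmem : s (pullback.snd p₁ ω x) ∈ (pullback.snd p₁ ω) ⁻¹' {pullback.snd p₁ ω x} := by
      rw [Set.mem_preimage, hsq]
      exact Set.mem_singleton _
    have hsub : (pullback.snd p₁ ω) ⁻¹' {pullback.snd p₁ ω x} ⊆ (U : Set ↥(pullback p₁ ω)) :=
      ((pullback.snd p₁ ω).isConnected_preimage_singleton (pullback.snd p₁ ω x)).isPreconnected.subset_isClopen
        hUc ⟨_, hmem, hx⟩
    exact hsub rfl
  -- `H₂ := W := s⁻¹(U)`, open in `Z`; `j₂ := W ↪ Z → H₁`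
  let W : Z.Opens := s ⁻¹ᵁ U
  have hWU : ∀ x : ↥(pullback p₁ ω), pullback.snd p₁ ω x ∈ W → x ∈ U := fun x hx => hfib x hx
  -- the canonical `κ : Z₁ ×_{H₁} W → Z₁ ×_{H₁} Z` (only its two defining equations are used)
  obtain ⟨κ, hκ₁, hκ₂⟩ : ∃ κ : pullback p₁ (W.ι ≫ ω) ⟶ pullback p₁ ω,
      κ ≫ pullback.fst p₁ ω = pullback.fst p₁ (W.ι ≫ ω) ∧ κ ≫ pullback.snd p₁ ω = pullback.snd p₁ (W.ι ≫ ω) ≫ W.ι :=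
    ⟨pullback.map p₁ (W.ι ≫ ω) p₁ ω (𝟙 Z₁) W.ι (𝟙 H₁) (by simp) (by simp), by simp, by simp⟩
  -- the law `G_Z` transported to `Z₁ ×_{H₁} W` (§1)
  obtain ⟨G, hGunit, -, -⟩ :=
    AbelianSchemeOver.exists_inducedLaw_of_point p₁ ε₁ ω GZ hunit (v := W.ι ≫ ω) W.ι rfl κ hκ₁ hκ₂
  -- `Z₁ ×_{H₁} W → W` is smooth of relative dimension `g`: `κ` is an open immersion INTO `U`
  have hdim : SmoothOfRelativeDimension g (pullback.snd p₁ (W.ι ≫ ω)) := by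
    have big : IsPullback (κ ≫ pullback.fst p₁ ω) (pullback.snd p₁ (W.ι ≫ ω)) p₁ (W.ι ≫ ω) := by
      rw [hκ₁]; exact IsPullback.of_hasPullback p₁ (W.ι ≫ ω)
    have sq : IsPullback κ (pullback.snd p₁ (W.ι ≫ ω)) (pullback.snd p₁ ω) W.ι :=
      IsPullback.of_right big hκ₂ (IsPullback.of_hasPullback p₁ ω)
    haveI hκo : IsOpenImmersion κ := MorphismProperty.of_isPullback (P := @IsOpenImmersion) sq.flip inferInstance
    have hrange : Set.range κ ⊆ Set.range U.ι := by
      rintro _ ⟨y, rfl⟩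
      rw [Scheme.Opens.range_ι]
      apply hWU
      rw [← Scheme.Hom.comp_apply, hκ₂, Scheme.Hom.comp_apply, Scheme.Opens.ι_apply]
      exact (pullback.snd p₁ (W.ι ≫ ω) y).2
    obtain ⟨κ', hκ'⟩ : ∃ κ' : pullback p₁ (W.ι ≫ ω) ⟶ U, κ' ≫ U.ι = κ :=
      ⟨IsOpenImmersion.lift U.ι κ hrange, IsOpenImmersion.lift_fac _ _ hrange⟩
    haveI : IsOpenImmersion κ' :=
      MorphismProperty.of_postcomp (W := @IsOpenImmersion) (W' := @IsOpenImmersion) κ' U.ι inferInstance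
        (by rw [hκ']; infer_instance)
    have h1 : SmoothOfRelativeDimension g (κ' ≫ U.ι ≫ pullback.snd p₁ ω) := IsZariskiLocalAtSource.comp hU κ'
    rw [← Category.assoc, hκ', hκ₂] at h1
    haveI := smoothOfRelativeDimension_isStableUnderBaseChange g
    exact MorphismProperty.of_postcomp (W := @SmoothOfRelativeDimension g) (W' := @IsOpenImmersion)
      (pullback.snd p₁ (W.ι ≫ ω)) W.ι inferInstance h1
  refine ⟨(W : Scheme.{0}), W.ι ≫ ω, inferInstance, G, hGunit, hdim, fun T v => ⟨?_, ?_⟩⟩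
  · -- (→) a point of `H₂` induces (§1) a law with unit `ε₁|_T`, of relative dimension `g` (base change)
    rintro ⟨w, hw, -⟩
    obtain ⟨G', hG'unit, -, -⟩ := AbelianSchemeOver.exists_inducedLaw_of_point p₁ ε₁ (W.ι ≫ ω) G hGunit (v := v) w hw
      (pullback.map p₁ v p₁ (W.ι ≫ ω) (𝟙 Z₁) w (𝟙 H₁) (by simp) (by simpa using hw.symm)) (by simp) (by simp)
    haveI := hdim
    exact ⟨G', hG'unit, smoothOfRelativeDimension_snd_of_comp_eq p₁ (W.ι ≫ ω) w hw g⟩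
  · -- (←) a law with unit `ε₁|_T` of relative dimension `g` on an ARBITRARY `T`: test at the residue fields
    rintro ⟨G', hG'unit, hG'dim⟩
    have hrange : Set.range v ⊆ Set.range (W.ι ≫ ω) := by
      rintro _ ⟨t, rfl⟩
      -- restriction of `G'` to `Spec κ(t)` (§1), a Noetherian test scheme: it factors through `ω` by a point `w₀`
      obtain ⟨G'', hG''unit, -, -⟩ := AbelianSchemeOver.exists_inducedLaw_of_point p₁ ε₁ v G' hG'unit
        (v := T.fromSpecResidueField t ≫ v) (T.fromSpecResidueField t) rfl
        (pullback.map p₁ (T.fromSpecResidueField t ≫ v) p₁ v (𝟙 Z₁) (T.fromSpecResidueField t) (𝟙 H₁)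
          (by simp) (by simp)) (by simp) (by simp)
      obtain ⟨w₀, hw₀, -⟩ := (hiff (T.fromSpecResidueField t ≫ v)).mpr ⟨G'', hG''unit⟩
      -- the fibre of `q` over `w₀` is `Z₁ ×_{H₁} Spec κ(t)`, smooth of relative dimension `g`: `w₀` lands in `W`
      haveI := hG'dim
      have hdim₀ : SmoothOfRelativeDimension g (pullback.snd p₁ (w₀ ≫ ω)) := by
        rw [hw₀]
        exact smoothOfRelativeDimension_snd_of_comp_eq p₁ v (T.fromSpecResidueField t) rfl g
      haveI : SmoothOfRelativeDimension g (pullback.snd (pullback.snd p₁ ω) w₀) :=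
        (smoothOfRelativeDimension_snd_snd_iff p₁ ω w₀ g).mpr hdim₀
      let pt : ↥(Spec (T.residueField t)) := default
      have hW : w₀ pt ∈ W := by
        show s (w₀ pt) ∈ U
        refine mem_of_smoothOfRelativeDimension_pullback_snd (pullback.snd p₁ ω) hUmax w₀ ?_
        rw [hsq]
        exact ⟨pt, rfl⟩
      refine ⟨⟨w₀ pt, hW⟩, ?_⟩
      calc (W.ι ≫ ω) ⟨w₀ pt, hW⟩ = ω (w₀ pt) := by rw [Scheme.Hom.comp_apply]; rfl
        _ = (w₀ ≫ ω) pt := by rw [Scheme.Hom.comp_apply]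
        _ = (T.fromSpecResidueField t ≫ v) pt := by rw [hw₀]
        _ = v t := by rw [Scheme.Hom.comp_apply, Scheme.fromSpecResidueField_apply]
    refine ⟨IsOpenImmersion.lift (W.ι ≫ ω) v hrange, IsOpenImmersion.lift_fac _ _ hrange, fun w' hw' => ?_⟩
    exact (cancel_mono (W.ι ≫ ω)).mp (hw'.trans (IsOpenImmersion.lift_fac _ _ hrange).symm)

end Literature.AlgebraicGeometry.AbelianSchemes
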